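import Literature.Computability.Complexity.GraphCanonizationProgramData
import HarnessLib

/-!
# The canoniser as a list program, II: ordered colour refinement on lists

The refiner of the canoniser (`GraphCanonizationRefiner.lean`: `CGCanon.crRefine G W c =
ocrIter (within G W) (liftCol W c) k`, the tree's ordered colour refinement
`Literature/Combinatorics/SimpleGraph/ColourRefinementOrder.lean`) as a list program:

* `nbrCountL` = `nbrCount` (neighbours of a colour in the state graph), `profLTL` = `ProfLT`
  (lexicographic comparison of the count vectors, quantified over vertices exactly as in the
  definition), `keyLTL` = `KeyLT`, `ocrStepL` = `ocrStep` (the new colour is the number of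
  vertices with a smaller key) — `ocrStepL_eq`;
* `refineL n A mask col = (ocrStepL …)^[n] (liftL mask col)` = `crRefine` (`refineL_eq`).

## References

* J.-Y. Cai, M. Fürer, N. Immerman, Combinatorica 12 (1992), §5 (vertex refinement). [CaiFurerImmerman1992]
* B. D. McKay, A. Piperno, J. Symbolic Comput. 60 (2014), §3.1. [MckayPiperno2014]
-/

namespace Literature.Computability.Complexity

open Literature.Combinatorics.SimpleGraph Finset ColourRefinementScheme

open scoped Classical

noncomputable section

namespace CGProg

variable {k : ℕ}

/-! ### Quantifiers over `Fin k` as `any` / `all` over `range k` -/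

/-- `any` over `range k` is `∃` over `Fin k`. [folklore] -/
theorem any_range_iff (q : ℕ → Bool) : (List.range k).any q = true ↔ ∃ i : Fin k, q i = true := by
  rw [List.any_eq_true]
  constructor
  · rintro ⟨n, hn, hqn⟩; exact ⟨⟨n, List.mem_range.1 hn⟩, hqn⟩
  · rintro ⟨i, hi⟩; exact ⟨i.val, List.mem_range.2 i.isLt, hi⟩

/-- `all` over `range k` is `∀` over `Fin k`. [folklore] -/
theorem all_range_iff (q : ℕ → Bool) : (List.range k).all q = true ↔ ∀ i : Fin k, q i = true := by
  rw [List.all_eq_true]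
  constructor
  · intro h i; exact h i.val (List.mem_range.2 i.isLt)
  · intro h n hn; exact h ⟨n, List.mem_range.1 hn⟩

/-! ### One round -/

/-- Neighbours of `u` of colour `a` in the state graph. [cite: CaiFurerImmerman1992, §5] -/
def nbrCountL (n : ℕ) (A : List (List Bool)) (mask : List Bool) (col : List ℕ) (u a : ℕ) : ℕ :=
  ((List.range n).filter fun w => adjW A mask u w && decide (natAt col w = a)).length

/-- `nbrCountL` is `nbrCount` of `within G W`. [folklore] -/
theorem nbrCountL_eq (G : SimpleGraph (Fin k)) (W : Finset (Fin k)) (ρ : Fin k → ℕ) (u : Fin k) (a : ℕ) :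
    nbrCountL k (adjOf G) (maskOf W) (colOf ρ) u a = nbrCount (CGCanon.within G W) ρ u a := by
  unfold nbrCountL nbrCount
  refine (card_filter_univ_eq_length _ _ fun w => ?_).symm
  rw [adjW_eq, natAt_colOf]
  by_cases h1 : (CGCanon.within G W).Adj u w <;> by_cases h2 : ρ w = a <;> simp_all

/-- The lexicographic comparison of count vectors, `ProfLT` on lists. [cite: CaiFurerImmerman1992, §5] -/
def profLTL (n : ℕ) (A : List (List Bool)) (mask : List Bool) (col : List ℕ) (v u : ℕ) : Bool :=
  (List.range n).any fun w =>
    decide (nbrCountL n A mask col v (natAt col w) < nbrCountL n A mask col u (natAt col w)) &&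
      (List.range n).all fun w' => !decide (natAt col w' < natAt col w) ||
        decide (nbrCountL n A mask col v (natAt col w') = nbrCountL n A mask col u (natAt col w'))

/-- `profLTL` is `ProfLT`. [folklore] -/
theorem profLTL_eq (G : SimpleGraph (Fin k)) (W : Finset (Fin k)) (ρ : Fin k → ℕ) (v u : Fin k) :
    profLTL k (adjOf G) (maskOf W) (colOf ρ) v u = decide (ProfLT (CGCanon.within G W) ρ v u) := by
  rw [Bool.eq_iff_iff, decide_eq_true_iff]
  unfold profLTL ProfLT
  rw [any_range_iff]
  refine exists_congr fun w => ?_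
  rw [Bool.and_eq_true, decide_eq_true_iff, natAt_colOf, nbrCountL_eq, nbrCountL_eq, all_range_iff]
  refine and_congr Iff.rfl (forall_congr' fun w' => ?_)
  rw [natAt_colOf, nbrCountL_eq, nbrCountL_eq, Bool.or_eq_true, Bool.not_eq_true', decide_eq_false_iff_not, decide_eq_true_iff]
  exact or_iff_not_imp_left.trans ⟨fun h h' => h (not_not.2 h'), fun h h' => h (not_not.1 h')⟩

/-- The key order, `KeyLT` on lists. [cite: CaiFurerImmerman1992, §5] -/
def keyLTL (n : ℕ) (A : List (List Bool)) (mask : List Bool) (col : List ℕ) (v u : ℕ) : Bool :=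
  decide (natAt col v < natAt col u) || (decide (natAt col v = natAt col u) && profLTL n A mask col v u)

/-- `keyLTL` is `KeyLT`. [folklore] -/
theorem keyLTL_eq (G : SimpleGraph (Fin k)) (W : Finset (Fin k)) (ρ : Fin k → ℕ) (v u : Fin k) :
    keyLTL k (adjOf G) (maskOf W) (colOf ρ) v u = decide (KeyLT (CGCanon.within G W) ρ v u) := by
  rw [Bool.eq_iff_iff, decide_eq_true_iff]
  unfold keyLTL KeyLT
  rw [Bool.or_eq_true, Bool.and_eq_true, decide_eq_true_iff, decide_eq_true_iff, natAt_colOf, natAt_colOf, profLTL_eq,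
    decide_eq_true_iff]

/-- **One round of ordered colour refinement on lists**: the new colour of `u` is the number of
vertices with a smaller key. [cite: CaiFurerImmerman1992, §5] -/
def ocrStepL (n : ℕ) (A : List (List Bool)) (mask : List Bool) (col : List ℕ) : List ℕ :=
  (List.range n).map fun u => ((List.range n).filter fun v => keyLTL n A mask col v u).length

/-- `ocrStepL` is `ocrStep` of `within G W`. [folklore] -/
theorem ocrStepL_eq (G : SimpleGraph (Fin k)) (W : Finset (Fin k)) (ρ : Fin k → ℕ) :
    ocrStepL k (adjOf G) (maskOf W) (colOf ρ) = colOf (ocrStep (CGCanon.within G W) ρ) := by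
  unfold ocrStepL colOf
  refine map_range_eq_ofFn fun u => ?_
  unfold ocrStep
  exact (card_filter_univ_eq_length _ _ fun v => (keyLTL_eq G W ρ v u).trans (decide_eq_decide.2 Iff.rfl)).symm

/-! ### The refiner -/

/-- **The refiner on lists**: `n` rounds from the lifted colouring. [cite: MckayPiperno2014, §3.1] -/
def refineL (n : ℕ) (A : List (List Bool)) (mask : List Bool) (col : List ℕ) : List ℕ :=
  (ocrStepL n A mask)^[n] (liftL mask col)

/-- Iterated rounds on lists are `ocrIter`. [folklore] -/
theorem ocrStepL_iterate_eq (G : SimpleGraph (Fin k)) (W : Finset (Fin k)) (ρ : Fin k → ℕ) :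
    ∀ t : ℕ, (ocrStepL k (adjOf G) (maskOf W))^[t] (colOf ρ) = colOf (ocrIter (CGCanon.within G W) ρ t)
  | 0 => rfl
  | t + 1 => by
    rw [Function.iterate_succ_apply', ocrStepL_iterate_eq G W ρ t, ocrStepL_eq, ocrIter_succ]

/-- **`refineL` is `crRefine`.** [folklore] -/
theorem refineL_eq (G : SimpleGraph (Fin k)) (W : Finset (Fin k)) (c : Fin k → ℕ) :
    refineL k (adjOf G) (maskOf W) (colOf c) = colOf (CGCanon.crRefine G W c) := by
  unfold refineL CGCanon.crRefine
  rw [liftL_eq, ocrStepL_iterate_eq]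

/-- Items of `refineL` on well-formed data. [folklore] -/
theorem natAt_refineL (G : SimpleGraph (Fin k)) (W : Finset (Fin k)) (c : Fin k → ℕ) (v : Fin k) :
    natAt (refineL k (adjOf G) (maskOf W) (colOf c)) v = CGCanon.crRefine G W c v := by
  rw [refineL_eq, natAt_colOf]

end CGProg

end

end Literature.Computability.Complexity
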